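import Mathlib
import Literature.AlgebraicGeometry.Aoki1983.SemiStandard

/-!
# The immortal classes at their own levels: `ξ₄₄`, `ξ₅₂`, `ξ₅₅` have order exactly `2` modulo `S + D` (THEOREM AX-ORDER)

Solo-blind programme on `KontsevichZagierPeriods`, session 58; companion of `SoloBlindFermat35` (the same statement
for `ξ₃₅`) and `SoloBlindAokiXi` (the programme's immortal torsion classes `α₄₄`, `α₅₂`, `a₅₅` are unit multiples of
the tree's `ξ₄₄`, `ξ₅₂`, `ξ₅₅` modulo one standard element and two pairs).

For each `q ∈ {44, 52, 55}` and the tree's semi-standard element `ξ_q` (`Literature.AlgebraicGeometry.Aoki1983.xi44/52/55`)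
this file proves, purely combinatorially (`decide`):
* an explicit identity `2·ξ_q + A_q = B_q` with `A_q`, `B_q` sums of pairs `{a, −a}`, the singleton `{q/2}` (even `q`)
  and Aoki's standard elements `σ_{p,i}` (`p` prime, `p ∣ q`; `σ_{2,i}` = the tree's `sigmaTwo`, `σ_{5,i}` = `sigmaFive`,
  `σ_{11,i}`, `σ_{13,i}` defined here) — so `2·ξ_q` is stably generated (`two_xiQ_stably_standard`);
* a parity functional `#(s ∩ W_q)`, `W₄₄ = {11, 33}`, `W₅₂ = {11, 15, 37, 41}`, `W₅₅ = {3, 8, 47, 52}` (`W = −W`, `q/2 ∉ W`),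
  even on every generator (every `i ∈ ℤ/q`, degenerate ones included) and equal to `1` on `ξ_q` — so `ξ_q` itself is
  NOT stably generated (`xiQ_not_stably_standard`).
Hence [K] the class of `ξ_q` has order exactly `2` in `B_q/(S_q + D_q)` for `q = 44, 52, 55` (and `35`, `SoloBlindFermat35`):
the four instances of [Aoki1983, Thm. D, Remark 5.4] at the levels of the programme's four immortal classes
`a_{5,7}, α₄₄, α₅₂, a_{5,11}`, each with explicit witnesses both ways.  With THEOREM Z⁺⁺ of the certificate: these order-2
classes are not stably generated by pairs, standard elements and semi-decomposable sextuples at ANY Fermat level `≤ 1200`.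
Nothing here asserts algebraicity of any class or bears on `KZPeriodConjecture` (typed wall W5‴ ⊂ W3).

## References
* [Aoki1983] N. Aoki, Math. Ann. 266 (1983) 23–54, §5 p. 36 (σ_{p,i}), p. 37 (ξ_q), Thm. D and Remark 5.4 p. 38.
* Programme files `SoloBlindFermat35`, `SoloBlindAokiXi`, `SoloBlindGammaValues` (`v44h`, `v52`, `v55`); search script
  `work/s58/order_q.py` (GF(2) parity system + integer echelon).
-/

open Literature.AlgebraicGeometry.HodgeTheory
open Literature.AlgebraicGeometry.Aoki1983

namespace Summit.KontsevichZagierPeriods.KontsevichZagierPeriods.Theorems.SoloBlind.AokiXiOrder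

/-! ### Level `44` -/

/-- Aoki's standard element `σ_{11,i} = (i, i+4, …, i+40, −11 i)` of level `44`, as a multiset.
[cite: Aoki1983, §5 p. 36 (σ_{p,i})] -/
def sigmaEleven44 (i : ZMod 44) : Multiset (ZMod 44) :=
  (Multiset.range 11).map (fun k : ℕ ↦ i + (k : ZMod 44) * 4) + {-(11 * i)}

/-- The generators of `S_44 + D_44` in effective form: pairs `{a, −a}`, the singleton `{22}`, `σ_{2,i}`, `σ_{11,i}`. [cite: Aoki1983, Thm. D p. 38] -/
def SDGen44 : Set (Multiset (ZMod 44)) :=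
  {s | (∃ a : ZMod 44, s = {a, -a}) ∨ s = {22} ∨ (∃ i : ZMod 44, s = sigmaTwo 44 i) ∨ (∃ i : ZMod 44, s = sigmaEleven44 i)}

/-- Left-hand side `A_44` of the certificate (10 generators). [folklore] -/
def certA44 : Multiset (ZMod 44) :=
  {2, -2} + {4, -4} + {8, -8} + {10, -10} + {17, -17} + {21, -21} + sigmaTwo 44 3 + sigmaTwo 44 6 + sigmaTwo 44 7 + sigmaTwo 44 9

/-- Right-hand side `B_44` of the certificate (11 generators). [folklore] -/
def certB44 : Multiset (ZMod 44) :=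
  {3, -3} + {6, -6} + {7, -7} + {13, -13} + sigmaTwo 44 1 + sigmaTwo 44 2 + sigmaTwo 44 4 + sigmaTwo 44 5 + sigmaTwo 44 8 + sigmaTwo 44 10 + sigmaEleven44 1

/-- **The `2`-torsion certificate at level `44`**: `2·ξ_44 + A_44 = B_44` as multisets.
[cite: Aoki1983, Thm. D and Remark 5.4 p. 38, instance m = 44 (explicit witness)] -/
theorem two_xi44_certificate : xi44 + xi44 + certA44 = certB44 := by
  unfold xi44 certA44 certB44 sigmaEleven44 sigmaTwo; decide +kernel

/-- `certA44` lies in the monoid generated by `SDGen44`. [folklore] -/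
theorem certA44_mem_closure : certA44 ∈ AddSubmonoid.closure SDGen44 := by
  unfold certA44
  refine add_mem (add_mem (add_mem (add_mem (add_mem (add_mem (add_mem (add_mem (add_mem ?_ ?_) ?_) ?_) ?_) ?_) ?_) ?_) ?_) ?_
  · exact AddSubmonoid.subset_closure (Or.inl ⟨_, rfl⟩)
  · exact AddSubmonoid.subset_closure (Or.inl ⟨_, rfl⟩)
  · exact AddSubmonoid.subset_closure (Or.inl ⟨_, rfl⟩)
  · exact AddSubmonoid.subset_closure (Or.inl ⟨_, rfl⟩)
  · exact AddSubmonoid.subset_closure (Or.inl ⟨_, rfl⟩)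
  · exact AddSubmonoid.subset_closure (Or.inl ⟨_, rfl⟩)
  · exact AddSubmonoid.subset_closure (Or.inr (Or.inr (Or.inl ⟨3, rfl⟩)))
  · exact AddSubmonoid.subset_closure (Or.inr (Or.inr (Or.inl ⟨6, rfl⟩)))
  · exact AddSubmonoid.subset_closure (Or.inr (Or.inr (Or.inl ⟨7, rfl⟩)))
  · exact AddSubmonoid.subset_closure (Or.inr (Or.inr (Or.inl ⟨9, rfl⟩)))

/-- `certB44` lies in the monoid generated by `SDGen44`. [folklore] -/
theorem certB44_mem_closure : certB44 ∈ AddSubmonoid.closure SDGen44 := by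
  unfold certB44
  refine add_mem (add_mem (add_mem (add_mem (add_mem (add_mem (add_mem (add_mem (add_mem (add_mem ?_ ?_) ?_) ?_) ?_) ?_) ?_) ?_) ?_) ?_) ?_
  · exact AddSubmonoid.subset_closure (Or.inl ⟨_, rfl⟩)
  · exact AddSubmonoid.subset_closure (Or.inl ⟨_, rfl⟩)
  · exact AddSubmonoid.subset_closure (Or.inl ⟨_, rfl⟩)
  · exact AddSubmonoid.subset_closure (Or.inl ⟨_, rfl⟩)
  · exact AddSubmonoid.subset_closure (Or.inr (Or.inr (Or.inl ⟨1, rfl⟩)))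
  · exact AddSubmonoid.subset_closure (Or.inr (Or.inr (Or.inl ⟨2, rfl⟩)))
  · exact AddSubmonoid.subset_closure (Or.inr (Or.inr (Or.inl ⟨4, rfl⟩)))
  · exact AddSubmonoid.subset_closure (Or.inr (Or.inr (Or.inl ⟨5, rfl⟩)))
  · exact AddSubmonoid.subset_closure (Or.inr (Or.inr (Or.inl ⟨8, rfl⟩)))
  · exact AddSubmonoid.subset_closure (Or.inr (Or.inr (Or.inl ⟨10, rfl⟩)))
  · exact AddSubmonoid.subset_closure (Or.inr (Or.inr (Or.inr ⟨1, rfl⟩)))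

/-- **`2·ξ_44` is stably generated by pairs, the singleton and standard elements.** [cite: Aoki1983, Thm. D and Remark 5.4, p. 38] -/
theorem two_xi44_stably_standard :
    ∃ A ∈ AddSubmonoid.closure SDGen44, ∃ B ∈ AddSubmonoid.closure SDGen44, xi44 + xi44 + A = B :=
  ⟨certA44, certA44_mem_closure, certB44, certB44_mem_closure, two_xi44_certificate⟩

/-- The parity functional at level `44`: the number of entries in `W = {11, 33}` (`W = −W`, `22 ∉ W`). [folklore] -/
def wcount44 (s : Multiset (ZMod 44)) : ℕ := Multiset.card (s.filter fun x ↦ x = 11 ∨ x = 33)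

/-- `wcount44` is additive. [folklore] -/
theorem wcount44_add (s t : Multiset (ZMod 44)) : wcount44 (s + t) = wcount44 s + wcount44 t := by
  simp [wcount44, Multiset.filter_add]

/-- Pairs have even `wcount44`. [folklore] -/
theorem even_wcount44_pair : ∀ a : ZMod 44, Even (wcount44 {a, -a}) := by
  unfold wcount44; decide

/-- The singleton `{22}` has `wcount44 = 0`. [folklore] -/
theorem even_wcount44_half : Even (wcount44 {22}) := by
  unfold wcount44; decide

/-- Every `σ_{2,i}` has even `wcount44`. [folklore] -/
theorem even_wcount44_sigmaTwo : ∀ i : ZMod 44, Even (wcount44 (sigmaTwo 44 i)) := by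
  unfold wcount44 sigmaTwo; decide

/-- Every `σ_{11,i}` has even `wcount44`. [folklore] -/
theorem even_wcount44_sigmaEleven : ∀ i : ZMod 44, Even (wcount44 (sigmaEleven44 i)) := by
  unfold wcount44 sigmaEleven44; decide

/-- Everything in the monoid generated by `SDGen44` has even `wcount44`. [folklore] -/
theorem even_wcount44_of_mem_closure {s : Multiset (ZMod 44)} (h : s ∈ AddSubmonoid.closure SDGen44) :
    Even (wcount44 s) := by
  induction h using AddSubmonoid.closure_induction with
  | mem x hx =>
    rcases hx with ⟨a, rfl⟩ | rfl | ⟨i, rfl⟩ | ⟨i, rfl⟩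
    · exact even_wcount44_pair a
    · exact even_wcount44_half
    · exact even_wcount44_sigmaTwo i
    · exact even_wcount44_sigmaEleven i
  | zero => exact ⟨0, rfl⟩
  | add x y _ _ hx hy => rw [wcount44_add]; exact hx.add hy

/-- `wcount44 ξ_44 = 1`. [folklore] -/
theorem wcount44_xi44 : wcount44 xi44 = 1 := by
  unfold wcount44 xi44; decide

/-- **`ξ_44` is not stably generated** by `SDGen44`; with `two_xi44_stably_standard` its class has order exactly `2`
modulo `S_44 + D_44`. [cite: Aoki1983, Thm. D and Remark 5.4, p. 38, instance m = 44] -/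
theorem xi44_not_stably_standard :
    ¬ ∃ A ∈ AddSubmonoid.closure SDGen44, ∃ B ∈ AddSubmonoid.closure SDGen44, xi44 + A = B := by
  rintro ⟨A, hA, B, hB, h⟩
  have hw := congrArg wcount44 h
  rw [wcount44_add, wcount44_xi44] at hw
  obtain ⟨a, ha⟩ := even_wcount44_of_mem_closure hA
  obtain ⟨b, hb⟩ := even_wcount44_of_mem_closure hB
  omega

/-! ### Level `52` -/

/-- Aoki's standard element `σ_{13,i} = (i, i+4, …, i+48, −13 i)` of level `52`, as a multiset.
[cite: Aoki1983, §5 p. 36 (σ_{p,i})] -/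
def sigmaThirteen52 (i : ZMod 52) : Multiset (ZMod 52) :=
  (Multiset.range 13).map (fun k : ℕ ↦ i + (k : ZMod 52) * 4) + {-(13 * i)}

/-- The generators of `S_52 + D_52` in effective form: pairs `{a, −a}`, the singleton `{26}`, `σ_{2,i}`, `σ_{13,i}`. [cite: Aoki1983, Thm. D p. 38] -/
def SDGen52 : Set (Multiset (ZMod 52)) :=
  {s | (∃ a : ZMod 52, s = {a, -a}) ∨ s = {26} ∨ (∃ i : ZMod 52, s = sigmaTwo 52 i) ∨ (∃ i : ZMod 52, s = sigmaThirteen52 i)}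

/-- Left-hand side `A_52` of the certificate (13 generators). [folklore] -/
def certA52 : Multiset (ZMod 52) :=
  {2, -2} + {3, -3} + {4, -4} + {6, -6} + {8, -8} + {12, -12} + {13, -13} + {25, -25} + sigmaTwo 52 5 + sigmaTwo 52 7 + sigmaTwo 52 9 + sigmaTwo 52 10 + sigmaTwo 52 11

/-- Right-hand side `B_52` of the certificate (13 generators). [folklore] -/
def certB52 : Multiset (ZMod 52) :=
  {7, -7} + {10, -10} + {11, -11} + {17, -17} + {21, -21} + sigmaTwo 52 1 + sigmaTwo 52 2 + sigmaTwo 52 3 + sigmaTwo 52 4 + sigmaTwo 52 6 + sigmaTwo 52 8 + sigmaTwo 52 12 + sigmaThirteen52 1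

/-- **The `2`-torsion certificate at level `52`**: `2·ξ_52 + A_52 = B_52` as multisets.
[cite: Aoki1983, Thm. D and Remark 5.4 p. 38, instance m = 52 (explicit witness)] -/
theorem two_xi52_certificate : xi52 + xi52 + certA52 = certB52 := by
  unfold xi52 certA52 certB52 sigmaThirteen52 sigmaTwo; decide +kernel

/-- `certA52` lies in the monoid generated by `SDGen52`. [folklore] -/
theorem certA52_mem_closure : certA52 ∈ AddSubmonoid.closure SDGen52 := by
  unfold certA52
  refine add_mem (add_mem (add_mem (add_mem (add_mem (add_mem (add_mem (add_mem (add_mem (add_mem (add_mem (add_mem ?_ ?_) ?_) ?_) ?_) ?_) ?_) ?_) ?_) ?_) ?_) ?_) ?_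
  · exact AddSubmonoid.subset_closure (Or.inl ⟨_, rfl⟩)
  · exact AddSubmonoid.subset_closure (Or.inl ⟨_, rfl⟩)
  · exact AddSubmonoid.subset_closure (Or.inl ⟨_, rfl⟩)
  · exact AddSubmonoid.subset_closure (Or.inl ⟨_, rfl⟩)
  · exact AddSubmonoid.subset_closure (Or.inl ⟨_, rfl⟩)
  · exact AddSubmonoid.subset_closure (Or.inl ⟨_, rfl⟩)
  · exact AddSubmonoid.subset_closure (Or.inl ⟨_, rfl⟩)
  · exact AddSubmonoid.subset_closure (Or.inl ⟨_, rfl⟩)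
  · exact AddSubmonoid.subset_closure (Or.inr (Or.inr (Or.inl ⟨5, rfl⟩)))
  · exact AddSubmonoid.subset_closure (Or.inr (Or.inr (Or.inl ⟨7, rfl⟩)))
  · exact AddSubmonoid.subset_closure (Or.inr (Or.inr (Or.inl ⟨9, rfl⟩)))
  · exact AddSubmonoid.subset_closure (Or.inr (Or.inr (Or.inl ⟨10, rfl⟩)))
  · exact AddSubmonoid.subset_closure (Or.inr (Or.inr (Or.inl ⟨11, rfl⟩)))

/-- `certB52` lies in the monoid generated by `SDGen52`. [folklore] -/
theorem certB52_mem_closure : certB52 ∈ AddSubmonoid.closure SDGen52 := by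
  unfold certB52
  refine add_mem (add_mem (add_mem (add_mem (add_mem (add_mem (add_mem (add_mem (add_mem (add_mem (add_mem (add_mem ?_ ?_) ?_) ?_) ?_) ?_) ?_) ?_) ?_) ?_) ?_) ?_) ?_
  · exact AddSubmonoid.subset_closure (Or.inl ⟨_, rfl⟩)
  · exact AddSubmonoid.subset_closure (Or.inl ⟨_, rfl⟩)
  · exact AddSubmonoid.subset_closure (Or.inl ⟨_, rfl⟩)
  · exact AddSubmonoid.subset_closure (Or.inl ⟨_, rfl⟩)
  · exact AddSubmonoid.subset_closure (Or.inl ⟨_, rfl⟩)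
  · exact AddSubmonoid.subset_closure (Or.inr (Or.inr (Or.inl ⟨1, rfl⟩)))
  · exact AddSubmonoid.subset_closure (Or.inr (Or.inr (Or.inl ⟨2, rfl⟩)))
  · exact AddSubmonoid.subset_closure (Or.inr (Or.inr (Or.inl ⟨3, rfl⟩)))
  · exact AddSubmonoid.subset_closure (Or.inr (Or.inr (Or.inl ⟨4, rfl⟩)))
  · exact AddSubmonoid.subset_closure (Or.inr (Or.inr (Or.inl ⟨6, rfl⟩)))
  · exact AddSubmonoid.subset_closure (Or.inr (Or.inr (Or.inl ⟨8, rfl⟩)))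
  · exact AddSubmonoid.subset_closure (Or.inr (Or.inr (Or.inl ⟨12, rfl⟩)))
  · exact AddSubmonoid.subset_closure (Or.inr (Or.inr (Or.inr ⟨1, rfl⟩)))

/-- **`2·ξ_52` is stably generated by pairs, the singleton and standard elements.** [cite: Aoki1983, Thm. D and Remark 5.4, p. 38] -/
theorem two_xi52_stably_standard :
    ∃ A ∈ AddSubmonoid.closure SDGen52, ∃ B ∈ AddSubmonoid.closure SDGen52, xi52 + xi52 + A = B :=
  ⟨certA52, certA52_mem_closure, certB52, certB52_mem_closure, two_xi52_certificate⟩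

/-- The parity functional at level `52`: the number of entries in `W = {11, 15, 37, 41}` (`W = −W`, `26 ∉ W`). [folklore] -/
def wcount52 (s : Multiset (ZMod 52)) : ℕ := Multiset.card (s.filter fun x ↦ x = 11 ∨ x = 15 ∨ x = 37 ∨ x = 41)

/-- `wcount52` is additive. [folklore] -/
theorem wcount52_add (s t : Multiset (ZMod 52)) : wcount52 (s + t) = wcount52 s + wcount52 t := by
  simp [wcount52, Multiset.filter_add]

/-- Pairs have even `wcount52`. [folklore] -/
theorem even_wcount52_pair : ∀ a : ZMod 52, Even (wcount52 {a, -a}) := by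
  unfold wcount52; decide

/-- The singleton `{26}` has `wcount52 = 0`. [folklore] -/
theorem even_wcount52_half : Even (wcount52 {26}) := by
  unfold wcount52; decide

/-- Every `σ_{2,i}` has even `wcount52`. [folklore] -/
theorem even_wcount52_sigmaTwo : ∀ i : ZMod 52, Even (wcount52 (sigmaTwo 52 i)) := by
  unfold wcount52 sigmaTwo; decide

/-- Every `σ_{13,i}` has even `wcount52`. [folklore] -/
theorem even_wcount52_sigmaThirteen : ∀ i : ZMod 52, Even (wcount52 (sigmaThirteen52 i)) := by
  unfold wcount52 sigmaThirteen52; decide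

/-- Everything in the monoid generated by `SDGen52` has even `wcount52`. [folklore] -/
theorem even_wcount52_of_mem_closure {s : Multiset (ZMod 52)} (h : s ∈ AddSubmonoid.closure SDGen52) :
    Even (wcount52 s) := by
  induction h using AddSubmonoid.closure_induction with
  | mem x hx =>
    rcases hx with ⟨a, rfl⟩ | rfl | ⟨i, rfl⟩ | ⟨i, rfl⟩
    · exact even_wcount52_pair a
    · exact even_wcount52_half
    · exact even_wcount52_sigmaTwo i
    · exact even_wcount52_sigmaThirteen i
  | zero => exact ⟨0, rfl⟩
  | add x y _ _ hx hy => rw [wcount52_add]; exact hx.add hy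

/-- `wcount52 ξ_52 = 1`. [folklore] -/
theorem wcount52_xi52 : wcount52 xi52 = 1 := by
  unfold wcount52 xi52; decide

/-- **`ξ_52` is not stably generated** by `SDGen52`; with `two_xi52_stably_standard` its class has order exactly `2`
modulo `S_52 + D_52`. [cite: Aoki1983, Thm. D and Remark 5.4, p. 38, instance m = 52] -/
theorem xi52_not_stably_standard :
    ¬ ∃ A ∈ AddSubmonoid.closure SDGen52, ∃ B ∈ AddSubmonoid.closure SDGen52, xi52 + A = B := by
  rintro ⟨A, hA, B, hB, h⟩
  have hw := congrArg wcount52 h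
  rw [wcount52_add, wcount52_xi52] at hw
  obtain ⟨a, ha⟩ := even_wcount52_of_mem_closure hA
  obtain ⟨b, hb⟩ := even_wcount52_of_mem_closure hB
  omega

/-! ### Level `55` -/

/-- Aoki's standard element `σ_{11,i} = (i, i+5, …, i+50, −11 i)` of level `55`, as a multiset.
[cite: Aoki1983, §5 p. 36 (σ_{p,i})] -/
def sigmaEleven55 (i : ZMod 55) : Multiset (ZMod 55) :=
  (Multiset.range 11).map (fun k : ℕ ↦ i + (k : ZMod 55) * 5) + {-(11 * i)}

/-- The generators of `S_55 + D_55` in effective form: pairs `{a, −a}`, `σ_{5,i}`, `σ_{11,i}`. [cite: Aoki1983, Thm. D p. 38] -/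
def SDGen55 : Set (Multiset (ZMod 55)) :=
  {s | (∃ a : ZMod 55, s = {a, -a}) ∨ (∃ i : ZMod 55, s = sigmaFive 55 i) ∨ (∃ i : ZMod 55, s = sigmaEleven55 i)}

/-- Left-hand side `A_55` of the certificate (12 generators). [folklore] -/
def certA55 : Multiset (ZMod 55) :=
  {4, -4} + {5, -5} + {6, -6} + {7, -7} + {11, -11} + {13, -13} + {17, -17} + {21, -21} + {22, -22} + {23, -23} + {24, -24} + sigmaFive 55 3

/-- Right-hand side `B_55` of the certificate (10 generators). [folklore] -/
def certB55 : Multiset (ZMod 55) :=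
  {3, -3} + {14, -14} + {15, -15} + {25, -25} + sigmaFive 55 1 + sigmaFive 55 2 + sigmaFive 55 4 + sigmaFive 55 5 + sigmaEleven55 1 + sigmaEleven55 2

/-- **The `2`-torsion certificate at level `55`**: `2·ξ_55 + A_55 = B_55` as multisets.
[cite: Aoki1983, Thm. D and Remark 5.4 p. 38, instance m = 55 (explicit witness)] -/
theorem two_xi55_certificate : xi55 + xi55 + certA55 = certB55 := by
  unfold xi55 certA55 certB55 sigmaEleven55 sigmaFive; decide +kernel

/-- `certA55` lies in the monoid generated by `SDGen55`. [folklore] -/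
theorem certA55_mem_closure : certA55 ∈ AddSubmonoid.closure SDGen55 := by
  unfold certA55
  refine add_mem (add_mem (add_mem (add_mem (add_mem (add_mem (add_mem (add_mem (add_mem (add_mem (add_mem ?_ ?_) ?_) ?_) ?_) ?_) ?_) ?_) ?_) ?_) ?_) ?_
  · exact AddSubmonoid.subset_closure (Or.inl ⟨_, rfl⟩)
  · exact AddSubmonoid.subset_closure (Or.inl ⟨_, rfl⟩)
  · exact AddSubmonoid.subset_closure (Or.inl ⟨_, rfl⟩)
  · exact AddSubmonoid.subset_closure (Or.inl ⟨_, rfl⟩)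
  · exact AddSubmonoid.subset_closure (Or.inl ⟨_, rfl⟩)
  · exact AddSubmonoid.subset_closure (Or.inl ⟨_, rfl⟩)
  · exact AddSubmonoid.subset_closure (Or.inl ⟨_, rfl⟩)
  · exact AddSubmonoid.subset_closure (Or.inl ⟨_, rfl⟩)
  · exact AddSubmonoid.subset_closure (Or.inl ⟨_, rfl⟩)
  · exact AddSubmonoid.subset_closure (Or.inl ⟨_, rfl⟩)
  · exact AddSubmonoid.subset_closure (Or.inl ⟨_, rfl⟩)
  · exact AddSubmonoid.subset_closure (Or.inr (Or.inl ⟨3, rfl⟩))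

/-- `certB55` lies in the monoid generated by `SDGen55`. [folklore] -/
theorem certB55_mem_closure : certB55 ∈ AddSubmonoid.closure SDGen55 := by
  unfold certB55
  refine add_mem (add_mem (add_mem (add_mem (add_mem (add_mem (add_mem (add_mem (add_mem ?_ ?_) ?_) ?_) ?_) ?_) ?_) ?_) ?_) ?_
  · exact AddSubmonoid.subset_closure (Or.inl ⟨_, rfl⟩)
  · exact AddSubmonoid.subset_closure (Or.inl ⟨_, rfl⟩)
  · exact AddSubmonoid.subset_closure (Or.inl ⟨_, rfl⟩)
  · exact AddSubmonoid.subset_closure (Or.inl ⟨_, rfl⟩)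
  · exact AddSubmonoid.subset_closure (Or.inr (Or.inl ⟨1, rfl⟩))
  · exact AddSubmonoid.subset_closure (Or.inr (Or.inl ⟨2, rfl⟩))
  · exact AddSubmonoid.subset_closure (Or.inr (Or.inl ⟨4, rfl⟩))
  · exact AddSubmonoid.subset_closure (Or.inr (Or.inl ⟨5, rfl⟩))
  · exact AddSubmonoid.subset_closure (Or.inr (Or.inr ⟨1, rfl⟩))
  · exact AddSubmonoid.subset_closure (Or.inr (Or.inr ⟨2, rfl⟩))

/-- **`2·ξ_55` is stably generated by pairs and standard elements.** [cite: Aoki1983, Thm. D and Remark 5.4, p. 38] -/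
theorem two_xi55_stably_standard :
    ∃ A ∈ AddSubmonoid.closure SDGen55, ∃ B ∈ AddSubmonoid.closure SDGen55, xi55 + xi55 + A = B :=
  ⟨certA55, certA55_mem_closure, certB55, certB55_mem_closure, two_xi55_certificate⟩

/-- The parity functional at level `55`: the number of entries in `W = {3, 8, 47, 52}` (`W = −W`). [folklore] -/
def wcount55 (s : Multiset (ZMod 55)) : ℕ := Multiset.card (s.filter fun x ↦ x = 3 ∨ x = 8 ∨ x = 47 ∨ x = 52)

/-- `wcount55` is additive. [folklore] -/
theorem wcount55_add (s t : Multiset (ZMod 55)) : wcount55 (s + t) = wcount55 s + wcount55 t := by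
  simp [wcount55, Multiset.filter_add]

/-- Pairs have even `wcount55`. [folklore] -/
theorem even_wcount55_pair : ∀ a : ZMod 55, Even (wcount55 {a, -a}) := by
  unfold wcount55; decide

/-- Every `σ_{5,i}` has even `wcount55`. [folklore] -/
theorem even_wcount55_sigmaFive : ∀ i : ZMod 55, Even (wcount55 (sigmaFive 55 i)) := by
  unfold wcount55 sigmaFive; decide

/-- Every `σ_{11,i}` has even `wcount55`. [folklore] -/
theorem even_wcount55_sigmaEleven : ∀ i : ZMod 55, Even (wcount55 (sigmaEleven55 i)) := by
  unfold wcount55 sigmaEleven55; decide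

/-- Everything in the monoid generated by `SDGen55` has even `wcount55`. [folklore] -/
theorem even_wcount55_of_mem_closure {s : Multiset (ZMod 55)} (h : s ∈ AddSubmonoid.closure SDGen55) :
    Even (wcount55 s) := by
  induction h using AddSubmonoid.closure_induction with
  | mem x hx =>
    rcases hx with ⟨a, rfl⟩ | ⟨i, rfl⟩ | ⟨i, rfl⟩
    · exact even_wcount55_pair a
    · exact even_wcount55_sigmaFive i
    · exact even_wcount55_sigmaEleven i
  | zero => exact ⟨0, rfl⟩
  | add x y _ _ hx hy => rw [wcount55_add]; exact hx.add hy

/-- `wcount55 ξ_55 = 1`. [folklore] -/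
theorem wcount55_xi55 : wcount55 xi55 = 1 := by
  unfold wcount55 xi55; decide

/-- **`ξ_55` is not stably generated** by `SDGen55`; with `two_xi55_stably_standard` its class has order exactly `2`
modulo `S_55 + D_55`. [cite: Aoki1983, Thm. D and Remark 5.4, p. 38, instance m = 55] -/
theorem xi55_not_stably_standard :
    ¬ ∃ A ∈ AddSubmonoid.closure SDGen55, ∃ B ∈ AddSubmonoid.closure SDGen55, xi55 + A = B := by
  rintro ⟨A, hA, B, hB, h⟩
  have hw := congrArg wcount55 h
  rw [wcount55_add, wcount55_xi55] at hw
  obtain ⟨a, ha⟩ := even_wcount55_of_mem_closure hA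
  obtain ⟨b, hb⟩ := even_wcount55_of_mem_closure hB
  omega

end Summit.KontsevichZagierPeriods.KontsevichZagierPeriods.Theorems.SoloBlind.AokiXiOrder
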